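import Summits.NavierStokesRegularity.NavierStokesRegularity.Theorems.ScenarioCensusLargeOrderRigidityStatements

/-!
# Scenario census, rows F13m / F13mL / F13dL — profile rigidity at diverging symmetry order:
# part 3/6: (P) weak-limit equivariance, PROVED (`weakLimitEquivariance_holds`)

Port of the ideator's tree-ready kit (ns-idea-9 g6, LINE 14 «dihedral_noswirl» REV 7 025308a3fa185027; kit file 1
`pub/ideators/ns-idea-9/lines/dihedral_noswirl/landing/ScenarioCensusLargeOrderRigidity.lean`, sha16 9e20ac97d4307bb6, 1417 l., its
declarations identical in REV 6/7; ref g7 PRE-CHECK ✓ §12.34, critic idea-crit-8 V56/V57/V58 PASS) by typer seat ns-census-typer-2 g8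
(lead g8 GO 2026-08-28T18:02Z; census FROZEN v1.62 — sub-row F13dL flips to TREE on port ACCEPT + ref CHECK), split for the
400-line rule into SIX modules `ScenarioCensusLargeOrderRigidity{Vocab, Statements, P, Geom, V}` → `ScenarioCensusLargeOrderRigidity`
(this last name is the kit's, so that kit file 2 `ScenarioCensusRowF13dLargeL3.lean` — ported by typer-1 g5 — imports it unchanged).
Declarations VERBATIM in the kit's namespace `…Theorems.ScenarioCensus.LargeOrderRigidity`; the only edits: the kit's
`local notation "ℝ³"` is replaced by the abbreviation `R3` (typer lint: no notation in ported files) and one-line docstrings are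
added to undocumented auxiliaries.

No census ROW value and no summit statement is proved in this file; `Row_F13mLarge` stays OPEN.
-/

noncomputable section

set_option linter.dupNamespace false
set_option linter.unusedVariables false

open Set Function Filter Topology MeasureTheory Metric TopologicalSpace
open scoped NNReal ENNReal RealInnerProductSpace

namespace Summit.NavierStokesRegularity.NavierStokesRegularity.Theorems.ScenarioCensus.LargeOrderRigidity

open Literature.Analysis Literature.Analysis.FluidPDE
open Summit.NavierStokesRegularity.NavierStokesRegularity.Theorems.ScenarioCensus

/-! ### (P) weak-limit equivariance — PROVED (rev 3)
Change of variables in the pairing (`integral_inner_comp_affine`), `‖φ ∘ A_j⁻¹ − φ ∘ A⁻¹‖_{3/2} → 0` for test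
fields by dominated convergence (`tendsto_eLpNorm_threeHalves_of_dominated`), Hölder `(3, 3/2)` with the budget
(`abs_integral_inner_le_eLpNorm_three_mul_threeHalves`, tree) and separation of `L³_loc` by test fields
(`ae_eq_of_forall_integral_inner_test_eq`, tree).  Standard axioms only. -/
section StubP
open Literature.Analysis.FunctionSpaces

/-- Auxiliary step of LINE 14 «dihedral_noswirl» (`isTestFunctionOn_comp_affine`), ported verbatim. -/
theorem isTestFunctionOn_comp_affine {φ : R3 → R3} (hφ : IsTestFunctionOn (⊤ : Opens R3) φ)
    (Λ : R3 ≃ₗᵢ[ℝ] R3) (β : R3) :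
    IsTestFunctionOn (⊤ : Opens R3) (fun x => φ (Λ.symm (x - β))) where
  contDiff := hφ.contDiff.comp
    (Λ.symm.toContinuousLinearEquiv.contDiff.comp (contDiff_id.sub contDiff_const))
  hasCompactSupport := by
    have h := hφ.hasCompactSupport.comp_homeomorph
      ((Homeomorph.subRight β).trans Λ.symm.toHomeomorph)
    have hfun : (fun x => φ (Λ.symm (x - β))) = φ ∘ ⇑((Homeomorph.subRight β).trans Λ.symm.toHomeomorph) := by
      funext x; simp
    rw [hfun]; exact h
  tsupport_subset := by simp

/-- Auxiliary step of LINE 14 «dihedral_noswirl» (`isTestFunctionOn_isometry_comp`), ported verbatim. -/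
theorem isTestFunctionOn_isometry_comp {φ : R3 → R3} (hφ : IsTestFunctionOn (⊤ : Opens R3) φ)
    (Λ : R3 ≃ₗᵢ[ℝ] R3) : IsTestFunctionOn (⊤ : Opens R3) (fun x => Λ (φ x)) where
  contDiff := Λ.toContinuousLinearEquiv.contDiff.comp hφ.contDiff
  hasCompactSupport := hφ.hasCompactSupport.comp_left (map_zero Λ)
  tsupport_subset := by simp

/-- Auxiliary step of LINE 14 «dihedral_noswirl» (`testFun_bound_radius`), ported verbatim. -/
theorem testFun_bound_radius {φ : R3 → R3}
    (hφ : IsTestFunctionOn (⊤ : Opens R3) φ) :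
    ∃ C R : ℝ, 0 ≤ C ∧ (∀ x, ‖φ x‖ ≤ C) ∧ ∀ x, R < ‖x‖ → φ x = 0 := by
  obtain ⟨C, hC⟩ := hφ.contDiff.continuous.bounded_above_of_compact_support hφ.hasCompactSupport
  obtain ⟨R, hR⟩ := (hφ.hasCompactSupport.isCompact.isBounded).subset_closedBall (0 : R3)
  refine ⟨C, R, (norm_nonneg _).trans (hC 0), hC, fun x hx => ?_⟩
  apply image_eq_zero_of_notMem_tsupport
  intro hx'
  have := hR hx'
  rw [mem_closedBall_zero_iff] at this
  exact absurd this (not_le.2 hx)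

/-- Auxiliary step of LINE 14 «dihedral_noswirl» (`testFun_memLp`), ported verbatim. -/
theorem testFun_memLp {φ : R3 → R3} (hφ : IsTestFunctionOn (⊤ : Opens R3) φ) (p : ℝ≥0∞) :
    MemLp φ p volume :=
  hφ.contDiff.continuous.memLp_of_hasCompactSupport hφ.hasCompactSupport

/-- pairings of an `L³` field with a test field converge absolutely. -/
theorem integrable_inner_test {u : R3 → R3} (hu : MemLp u 3 volume) {φ : R3 → R3}
    (hφ : IsTestFunctionOn (⊤ : Opens R3) φ) : Integrable (fun x => ⟪u x, φ x⟫) volume :=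
  ae_eq_of_forall_integral_inner_test_eq.integrable_inner_of_locallyIntegrable_test
    (hu.locallyIntegrable (by norm_num)) hφ

/-! ### `L^{3/2}` convergence of uniformly bounded, uniformly supported, pointwise convergent fields -/

/-- Auxiliary step of LINE 14 «dihedral_noswirl» (`tendsto_eLpNorm_threeHalves_of_dominated`), ported verbatim. -/
theorem tendsto_eLpNorm_threeHalves_of_dominated {g : ℕ → R3 → R3} (hgm : ∀ j, Continuous (g j))
    {C R : ℝ} (hC : ∀ j x, ‖g j x‖ ≤ C) (hR : ∀ j x, R < ‖x‖ → g j x = 0)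
    (hpt : ∀ x, Tendsto (fun j => g j x) atTop (𝓝 0)) :
    Tendsto (fun j => (eLpNorm (g j) (3 / 2 : ℝ≥0∞) volume).toReal) atTop (𝓝 0) := by
  have hp0 : (3 / 2 : ℝ≥0∞) ≠ 0 := by norm_num
  have hptop : (3 / 2 : ℝ≥0∞) ≠ ∞ := ENNReal.div_ne_top (by norm_num) (by norm_num)
  have hpr : (3 / 2 : ℝ≥0∞).toReal = 3 / 2 := by
    rw [ENNReal.toReal_div]; norm_num
  -- dominated convergence for `∫⁻ ‖g_j‖ₑ ^ (3/2)`
  set bound : R3 → ℝ≥0∞ := (closedBall (0 : R3) R).indicator fun _ => ENNReal.ofReal C ^ (3 / 2 : ℝ)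
    with hbound
  have hlin : Tendsto (fun j => ∫⁻ x, ‖g j x‖ₑ ^ (3 / 2 : ℝ)) atTop (𝓝 (∫⁻ _ : R3, (0 : ℝ≥0∞))) := by
    refine tendsto_lintegral_of_dominated_convergence bound (fun j => ?_) (fun j => ?_) ?_ ?_
    · exact (hgm j).measurable.enorm.pow_const _
    · refine Eventually.of_forall fun x => ?_
      by_cases hx : x ∈ closedBall (0 : R3) R
      · simp only [hbound, indicator_of_mem hx]
        gcongr
        rw [← ofReal_norm]
        exact ENNReal.ofReal_le_ofReal (hC j x)
      · have : g j x = 0 := hR j x (by rw [mem_closedBall_zero_iff, not_le] at hx; exact hx)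
        simp [this]
    · simp only [hbound, lintegral_indicator measurableSet_closedBall, lintegral_const,
        Measure.restrict_apply MeasurableSet.univ, univ_inter]
      exact ENNReal.mul_ne_top (ENNReal.rpow_ne_top_of_nonneg (by norm_num) ENNReal.ofReal_ne_top)
        measure_closedBall_lt_top.ne
    · refine Eventually.of_forall fun x => ?_
      have h1 : Tendsto (fun j => ‖g j x‖ₑ) atTop (𝓝 0) := by
        have := (hpt x).norm
        rw [norm_zero] at this
        have h2 : Tendsto (fun j => ENNReal.ofReal ‖g j x‖) atTop (𝓝 (ENNReal.ofReal 0)) :=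
          ENNReal.tendsto_ofReal this
        rw [ENNReal.ofReal_zero] at h2
        exact h2.congr fun j => ofReal_norm _
      have h3 := ((ENNReal.continuous_rpow_const (y := (3 / 2 : ℝ))).tendsto 0).comp h1
      simpa [Function.comp_def, ENNReal.zero_rpow_of_pos (show (0:ℝ) < 3 / 2 by norm_num)] using h3
  simp only [lintegral_zero] at hlin
  have hsn : ∀ j, eLpNorm (g j) (3 / 2 : ℝ≥0∞) volume
      = (∫⁻ x, ‖g j x‖ₑ ^ (3 / 2 : ℝ)) ^ (1 / (3 / 2 : ℝ)) := by
    intro j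
    rw [eLpNorm_eq_lintegral_rpow_enorm_toReal hp0 hptop, hpr]
  have h4 : Tendsto (fun j => eLpNorm (g j) (3 / 2 : ℝ≥0∞) volume) atTop (𝓝 0) := by
    have := ((ENNReal.continuous_rpow_const (y := (1 / (3 / 2) : ℝ))).tendsto 0).comp hlin
    simp only [ENNReal.zero_rpow_of_pos (show (0:ℝ) < 1 / (3 / 2) by norm_num)] at this
    exact this.congr fun j => (hsn j).symm
  have := (ENNReal.tendsto_toReal ENNReal.zero_ne_top).comp h4
  simpa [Function.comp_def] using this

/-- **moving test fields**: `a_j ⇀ f`, `‖a_j‖₃ ≤ M`, test fields `g_j → g'` pointwise with a common bound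
and a common support radius ⇒ `⟨a_j, g_j⟩ → ⟨f, g'⟩`. -/
theorem tendsto_pairing_of_tendsto_test {M : ℝ≥0} {a : ℕ → R3 → R3} {f : R3 → R3}
    (ha : ∀ j, MemLp (a j) 3 volume ∧ eLpNorm (a j) 3 volume ≤ (M : ℝ≥0∞))
    (hweak : WeakTo a f) {g : ℕ → R3 → R3} {g' : R3 → R3}
    (hg : ∀ j, IsTestFunctionOn (⊤ : Opens R3) (g j)) (hg' : IsTestFunctionOn (⊤ : Opens R3) g')
    {C R : ℝ} (hC : ∀ j x, ‖g j x‖ ≤ C) (hC' : ∀ x, ‖g' x‖ ≤ C) (hR : ∀ j x, R < ‖x‖ → g j x = 0)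
    (hR' : ∀ x, R < ‖x‖ → g' x = 0) (hpt : ∀ x, Tendsto (fun j => g j x) atTop (𝓝 (g' x))) :
    Tendsto (fun j => ∫ x, ⟪a j x, g j x⟫) atTop (𝓝 (∫ x, ⟪f x, g' x⟫)) := by
  -- split `⟨a_j, g_j⟩ = ⟨a_j, g'⟩ + ⟨a_j, g_j − g'⟩`
  have hsplit : ∀ j, ∫ x, ⟪a j x, g j x⟫ = (∫ x, ⟪a j x, g' x⟫) + ∫ x, ⟪a j x, g j x - g' x⟫ := by
    intro j
    have hint : Integrable (fun x => ⟪a j x, g j x - g' x⟫) volume := by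
      have := (integrable_inner_test (ha j).1 (hg j)).sub (integrable_inner_test (ha j).1 hg')
      refine this.congr (Eventually.of_forall fun x => ?_)
      simp only [Pi.sub_apply, inner_sub_right]
    rw [← integral_add (integrable_inner_test (ha j).1 hg') hint]
    refine integral_congr_ae (Eventually.of_forall fun x => ?_)
    simp only [inner_sub_right]; ring
  simp_rw [hsplit]
  rw [← add_zero (∫ x, ⟪f x, g' x⟫)]
  refine (hweak g' hg').add ?_
  -- the error term: Hölder with the budget and `‖g_j − g'‖_{3/2} → 0`
  have hd : Tendsto (fun j => (eLpNorm (g j - g') (3 / 2 : ℝ≥0∞) volume).toReal) atTop (𝓝 0) := by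
    refine tendsto_eLpNorm_threeHalves_of_dominated (g := fun j => g j - g') (C := C + C) (R := R)
      (fun j => (hg j).contDiff.continuous.sub hg'.contDiff.continuous) (fun j x => ?_)
      (fun j x hx => by simp [hR j x hx, hR' x hx]) (fun x => ?_)
    · exact (norm_sub_le _ _).trans (add_le_add (hC j x) (hC' x))
    · have := (hpt x).sub_const (g' x)
      simpa using this
  refine squeeze_zero_norm (fun j => ?_) (by simpa using hd.const_mul (M : ℝ))
  rw [Real.norm_eq_abs]
  calc |∫ x, ⟪a j x, g j x - g' x⟫|
      ≤ (eLpNorm (a j) 3 volume).toReal * (eLpNorm (g j - g') (3 / 2 : ℝ≥0∞) volume).toReal :=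
        abs_integral_inner_le_eLpNorm_three_mul_threeHalves (ha j).1
          ((testFun_memLp (hg j) _).sub (testFun_memLp hg' _))
    _ ≤ M * (eLpNorm (g j - g') (3 / 2 : ℝ≥0∞) volume).toReal := by
        gcongr
        exact_mod_cast ENNReal.toReal_mono ENNReal.coe_ne_top (ha j).2

/-! ### change of variables and the main statement -/

/-- Auxiliary step of LINE 14 «dihedral_noswirl» (`integral_inner_comp_affine`), ported verbatim. -/
theorem integral_inner_comp_affine (u φ : R3 → R3) (Λ : R3 ≃ₗᵢ[ℝ] R3) (β : R3) :
    ∫ y, ⟪u (β + Λ y), φ y⟫ = ∫ x, ⟪u x, φ (Λ.symm (x - β))⟫ := by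
  have hT : MeasurePreserving (fun y : R3 => β + Λ y) volume volume :=
    (measurePreserving_add_left volume β).comp Λ.measurePreserving
  have hemb : MeasurableEmbedding (fun y : R3 => β + Λ y) :=
    (Homeomorph.addLeft β).measurableEmbedding.comp Λ.toHomeomorph.measurableEmbedding
  have := hT.integral_comp hemb (fun x => ⟪u x, φ (Λ.symm (x - β))⟫)
  rw [← this]
  simp only [add_sub_cancel_left, LinearIsometryEquiv.symm_apply_apply]

/-- Auxiliary step of LINE 14 «dihedral_noswirl» (`tendsto_symm_of_tendsto`), ported verbatim. -/
theorem tendsto_symm_of_tendsto {L : ℕ → R3 ≃ₗᵢ[ℝ] R3} {L' : R3 ≃ₗᵢ[ℝ] R3}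
    (hL : ∀ y, Tendsto (fun j => L j y) atTop (𝓝 (L' y))) (w : R3) :
    Tendsto (fun j => (L j).symm w) atTop (𝓝 (L'.symm w)) := by
  rw [tendsto_iff_norm_sub_tendsto_zero]
  have : ∀ j, ‖(L j).symm w - L'.symm w‖ = ‖L j (L'.symm w) - L' (L'.symm w)‖ := by
    intro j
    rw [← (L j).norm_map ((L j).symm w - L'.symm w), map_sub, LinearIsometryEquiv.apply_symm_apply,
      L'.apply_symm_apply, norm_sub_rev]
  simp_rw [this]
  exact tendsto_iff_norm_sub_tendsto_zero.1 (hL (L'.symm w))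

/-- **(P) holds** (rev 3: formerly `stub_weakLimitEquivariance … sorry`). -/
theorem weakLimitEquivariance_holds : WeakLimitEquivariance := by
  intro M a f b L b' L' ha hf hweak hb hL hequi
  have hmp : MeasurePreserving (fun y : R3 => b' + L' y) volume volume :=
    (measurePreserving_add_left volume b').comp L'.measurePreserving
  have h1 : MemLp (fun y => f (b' + L' y)) 3 volume := hf.comp_measurePreserving hmp
  have h2 : MemLp (fun y => L' (f y)) 3 volume := by
    have := (L'.toContinuousLinearEquiv : R3 →L[ℝ] R3).comp_memLp' hf
    simpa [Function.comp_def] using this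
  refine ae_eq_of_forall_integral_inner_test_eq (h1.locallyIntegrable (by norm_num))
    (h2.locallyIntegrable (by norm_num)) fun φ hφ => ?_
  obtain ⟨C, R, -, hC, hR⟩ := testFun_bound_radius hφ
  obtain ⟨Cb, hCb⟩ : ∃ Cb : ℝ, ∀ j, ‖b j‖ ≤ Cb := by
    obtain ⟨Cb, hCb⟩ := isBounded_iff_forall_norm_le.1 (Metric.isBounded_range_of_tendsto b hb)
    exact ⟨Cb, fun j => hCb _ (mem_range_self j)⟩
  have hLs := tendsto_symm_of_tendsto hL
  -- the identity `⟨a_j, φ ∘ A_j⁻¹⟩ = ⟨a_j, L_j⁻¹ ∘ φ⟩` for each `j`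
  have hid : ∀ j, ∫ x, ⟪a j x, φ ((L j).symm (x - b j))⟫ = ∫ x, ⟪a j x, (L j).symm (φ x)⟫ := by
    intro j
    rw [← integral_inner_comp_affine (a j) φ (L j) (b j)]
    refine integral_congr_ae (Eventually.of_forall fun y => ?_)
    simp only [hequi j y]
    rw [← (L j).inner_map_map (a j y) ((L j).symm (φ y)), LinearIsometryEquiv.apply_symm_apply]
  -- limits of both sides
  have hlimψ : Tendsto (fun j => ∫ x, ⟪a j x, φ ((L j).symm (x - b j))⟫) atTop
      (𝓝 (∫ x, ⟪f x, φ (L'.symm (x - b'))⟫)) := by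
    refine tendsto_pairing_of_tendsto_test ha hweak
      (fun j => isTestFunctionOn_comp_affine hφ (L j) (b j)) (isTestFunctionOn_comp_affine hφ L' b')
      (C := C) (R := R + max Cb ‖b'‖) (fun j x => hC _) (fun x => hC _) (fun j x hx => ?_)
      (fun x hx => ?_) (fun x => ?_)
    · apply hR
      rw [LinearIsometryEquiv.norm_map]
      have h3 := norm_sub_norm_le x (b j)
      have h4 : ‖b j‖ ≤ max Cb ‖b'‖ := (hCb j).trans (le_max_left _ _)
      linarith
    · apply hR
      rw [LinearIsometryEquiv.norm_map]
      have h3 := norm_sub_norm_le x b'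
      have h4 := le_max_right Cb ‖b'‖
      linarith
    · have harg : Tendsto (fun j => (L j).symm (x - b j)) atTop (𝓝 (L'.symm (x - b'))) := by
        have e1 : Tendsto (fun j => (L j).symm (x - b j) - (L j).symm (x - b')) atTop (𝓝 0) := by
          rw [tendsto_iff_norm_sub_tendsto_zero]
          have : ∀ j, ‖(L j).symm (x - b j) - (L j).symm (x - b') - 0‖ = ‖b j - b'‖ := by
            intro j
            rw [sub_zero, ← map_sub, LinearIsometryEquiv.norm_map, ← norm_neg]
            congr 1; abel
          simp_rw [this]
          exact tendsto_iff_norm_sub_tendsto_zero.1 hb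
        have e2 := e1.add (hLs (x - b'))
        simpa using e2
      exact (hφ.contDiff.continuous.tendsto _).comp harg
  have hlimχ : Tendsto (fun j => ∫ x, ⟪a j x, (L j).symm (φ x)⟫) atTop
      (𝓝 (∫ x, ⟪f x, L'.symm (φ x)⟫)) :=
    tendsto_pairing_of_tendsto_test ha hweak (fun j => isTestFunctionOn_isometry_comp hφ (L j).symm)
      (isTestFunctionOn_isometry_comp hφ L'.symm) (C := C) (R := R)
      (fun j x => by rw [LinearIsometryEquiv.norm_map]; exact hC x)
      (fun x => by rw [LinearIsometryEquiv.norm_map]; exact hC x)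
      (fun j x hx => by simp [hR x hx]) (fun x hx => by simp [hR x hx]) (fun x => hLs (φ x))
  have heq : ∫ x, ⟪f x, φ (L'.symm (x - b'))⟫ = ∫ x, ⟪f x, L'.symm (φ x)⟫ :=
    tendsto_nhds_unique hlimψ (hlimχ.congr fun j => (hid j).symm)
  -- conclude
  rw [integral_inner_comp_affine f φ L' b', heq]
  refine integral_congr_ae (Eventually.of_forall fun y => ?_)
  show ⟪f y, L'.symm (φ y)⟫ = ⟪L' (f y), φ y⟫
  rw [← L'.inner_map_map (f y) (L'.symm (φ y)), LinearIsometryEquiv.apply_symm_apply]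

end StubP
end Summit.NavierStokesRegularity.NavierStokesRegularity.Theorems.ScenarioCensus.LargeOrderRigidity

end
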